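import Summits.QuantumFields.YangMills.Theorems.AlphaInputsT3ACv3SymAvgSixtyNine
import HarnessLib

/-!
# `AlphaInputsT3ACv3SymAvgSixtyNineOfExpansion` — (69)_sym FOR THE SYMMETRIC (0.4)-AVERAGE, **ENGINE-GENERIC**: the four `P`-generic links of the (69)_sym ∕ (71)_sym seam chain
# (✓`SymAvgPlaqAssembly` §3, ✓`SymAvgBlockSum69` §3, ✓`SymAvgGaugeClamp` §5, ✓`SymAvgSixtyNine` §2) re-stated with [Balaban1985Averaging] Prop. 4's OUTPUT — the size bound `M`
# and the second-order remainder `R` of the `s`-fold average at the level in hand — as HYPOTHESES instead of a call of one particular Prop-4 engine, so that NO block-size floor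
# (`d + 2 ≤ L` of ✓R1 `EMLIterUniform.norm_iter_sub_one_sub_iterLin_le_uniform` = L-FLOOR LF-2 of ★★OWNER RULING g26-№20) is threaded through the chain: the T³ knit chooses the
# engine (✓R1 at `L ≥ 5`; `EMLIterUniform.norm_iter_sub_one_sub_iterLin_le_uniform_dL` at `L ≥ d`; ★w5's `EMLIterUniformAllL.…_allL` at `L ≥ 2`) — cell `ym3-torus`, crux
# stmt-QuantumFields-19936 (O″χ) seam R-ii, LEAD seat `ym-ust-19936-w1` (g3), split (C1) of 2026-08-28T08:55Z

WHY.  In the landed chain the Prop-4 engine enters at exactly two places — `SymAvgPlaqAssembly.dist1_plaqHol_iter_le_uniform` (the coarse end of piece (iii)) and the last conjunct of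
`SymAvgGaugeClamp.exists_clamp_expansion` (the engine applied to the clamped copy `Ũ`) — and everywhere else its binders (`hL : d + 2 ≤ L`, the two windows, the constant
`324·L·(d+2)²`) are pure pass-through (★w2-19936 g4 08:39:37Z (3)).  Abstracting the engine's two outputs at the level in hand, `‖Ū^{(s)}(c) − 1‖ ≤ M ≤ 1` and
`‖Ū^{(s)}(c) − 1 − (Q^{(s)}Y)(c)‖ ≤ R`, makes every link floor-free and constant-free; the remainder of (69)_sym becomes `13·(L^sδ)² + (4R + 13M²)` (with `M = 2m_s`, `R = C·m_s²` this is
the landed `13·(L^sδ)² + (4C + 52)·m_s²`).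
WHAT (def-free; proofs are the landed ones with the engine call replaced by the hypothesis, the coarse end of piece (iii) being ✓`SymAvgPlaqAssembly.dist1_plaqHol_le_norm_curl_add`).
§1 ★★ `dist1_plaqHol_iter_le_tripleSum_of_expansion` (torus form of (69)_sym, generic `P`, `SU(n)`, flat gauge `‖U_b − 1‖ ≤ δ ≤ 1`); §2 ★★
`dist1_plaqHol_iter_le_blockSum_of_expansion` (the (70)–(71) letters `blockSum`∕`dev`∕`liftCfg` on the tori of a `Scales`); §3 ★★★ `dist1_plaqHol_iter_le_blockSum_of_cover_of_expansion`
— (69)_sym for a READ-regular field (plaquette bound `a` on the cover `Δ′(p′)`, `δ := (d+2)L^j·a ≤ 1`), the engine displayed as `hP4 : ∀ Ũ, (∀ b, ‖Ũ_b − 1‖ ≤ δ) → ∀ c, ‖Ū̃^{(j)}(c) − 1‖ ≤ M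
∧ ‖Ū̃^{(j)}(c) − 1 − (Q^{(j)}Ỹ)(c)‖ ≤ R` for the linearised average of record `Q = linAvgIterM`.
HONEST FRAMING.  Re-plumbing of four landed theorems (★w7-19936 g3, ★w2-19936 g4) — no new estimate; the engines, the (68) reading, the T³ knit with its window numerals
(`…SymAvgSixtyNineT3`, split (C2)) and the seam row are NOT here; nothing of [Balaban1985UV3] (69)–(71) is asserted beyond these letters; the stub 2′χ, the crux `HistoryTailL` and any
gap are NOT closed; count-neutral helper (`--supports stmt-QuantumFields-19936`); registry untouched.  YM₃ on the three-torus is rung R3 of the programme (finite-torus SU(2)), NOT the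
Clay problem: nothing here bears on d = 4, infinite volume, the continuum, or a mass gap.

References: T. Bałaban, Commun. Math. Phys. 102 (1985) 255–275 [Balaban1985UV3] ((67)–(71) p.273); Commun. Math. Phys. 98 (1985) 17–51 [Balaban1985Averaging] ((8)–(11) p.19,
Prop. 1 (48)–(51) pp.25–26, Prop. 2 (52)–(54) p.26, Prop. 4 (134)–(135) p.38).
-/

set_option autoImplicit false

noncomputable section

open scoped Matrix.Norms.L2Operator BigOperators

namespace Summit.QuantumFields.YangMills.Theorems.SymAvgSixtyNineOfExpansion

open Finset
open Literature.MathematicalPhysics.QuantumFieldTheory.Balaban1983to89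
open Literature.MathematicalPhysics.QuantumFieldTheory.Balaban1985CMP102.Setting
open Literature.MathematicalPhysics.QuantumFieldTheory.Balaban1983to89.B10Eq38TorusDomains (plaqsIn)
open T4Continuum AveragingRT BlockAveraging ExpMeanLog BlockAveragingEMLLinearised LatticeFieldCalculus
open Summit.QuantumFields.Balaban3D.Carriers (plaqCover)
open Summit.QuantumFields.Balaban3D.Proofs.LiftBridge (liftCfg)
open Summit.QuantumFields.Balaban3D.Proofs.TorusLift (zOf)
open Summit.QuantumFields.YangMills.Theorems.BalabanUVNodesN08AlphaRegSel (plaqVar)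
open Summit.QuantumFields.YangMills.Theorems.SymAvgPlaqAssembly (dist1_plaqHol_le_norm_curl_add norm_fineCurl_le_dist1_add)
open Summit.QuantumFields.YangMills.Theorems.LinAvgIterFluxRigid (curl_iterLinAvg_eq_rigidFlux_offsets)
open Summit.QuantumFields.YangMills.Theorems.SymAvgGaugeClamp (exists_clamp)
open Summit.QuantumFields.YangMills.Theorems.SymAvgBlockSum69 (blockSum_dev_liftCfg_eq)
open Summit.QuantumFields.YangMills.Theorems.SymAvgSixtyNine (blockSum_dev_liftCfg_congr_of_cover)
open Summit.QuantumFields.YangMills.Theorems.LinearLiftMatrix (linAvgIterM linAvgIterM_zero linAvgIterM_succ)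
open Summit.QuantumFields.YangMills.Theorems.PerturbedPlaquette (dist1_SU_eq)

/-! ## §1 (69)_sym, torus form, from the expansion at the level in hand -/

section Torus

variable {P : Params} {n : Type*} [Fintype n] [DecidableEq n] [Nonempty n]

/-- `runSite x μ 1 = x + e_μ`. [folklore] -/
private theorem runSite_one' {j : ℕ} (x : Site P j) (μ : Fin P.d) : runSite x μ 1 = x.shift μ := by
  rw [show (1 : ℕ) = 0 + 1 from rfl, runSite_succ, runSite_zero]

/-- **★★ (69)_sym, TORUS FORM, ENGINE-GENERIC** (generic torus `P`, `SU(n)`, flat gauge `‖U_b − 1‖ ≤ δ ≤ 1`).  Let `Q` be a linearised-average family (`Q 0 = id`,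
`Q (s+1) Y c = linAvg (Q s Y) c`), `s ≤ m + K`, `p′ : Plaq P s`, and suppose the `s`-fold (0.4)-average of record satisfies `‖Ū^{(s)}(c) − 1‖ ≤ M ≤ 1` and
`‖Ū^{(s)}(c) − 1 − (Q^{(s)}Y)(c)‖ ≤ R` at every level-`s` bond (`Y = U − 1`; [Balaban1985Averaging] Prop. 4 by ANY engine).  Then
`|Ū^{(s)}(∂p′) − 1| ≤ ((L^s)^d)⁻¹·Σ_r Σ_{a,b<L^s} ‖U(∂z_{r,a,b}) − 1‖ + 13·(L^sδ)² + (4R + 13M²)`, `z_{r,a,b} = runSite (runSite (fibreSite 0 s p′.src r) μ a) ν b` — pieces (i)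
(`curl_iterLinAvg_eq_rigidFlux_offsets`) and (iii) (`norm_fineCurl_le_dist1_add`, `dist1_plaqHol_le_norm_curl_add`) BY NAME; the proof is ✓`SymAvgBlockSum69.dist1_plaqHol_iter_le_tripleSum`'s with the engine call
replaced by the hypotheses. [cite: Balaban1985UV3, (69) p.273; Balaban1985Averaging, Prop. 1 (48)–(51) pp.25–26, Prop. 4 (134)–(135) p.38] -/
theorem dist1_plaqHol_iter_le_tripleSum_of_expansion
    (Q : (i : ℕ) → (PBond P 0 → Matrix n n ℂ) → PBond P i → Matrix n n ℂ)
    (hQ0 : ∀ Y, Q 0 Y = Y) (hQs : ∀ (i : ℕ) (Y : PBond P 0 → Matrix n n ℂ) (c : PBond P (i + 1)), Q (i + 1) Y c = linAvg (Q i Y) c)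
    (U : GaugeField P 0 (Matrix.specialUnitaryGroup n ℂ)) {δ : ℝ} (hδ1 : δ ≤ 1)
    (hU : ∀ b, ‖((U b : Matrix.specialUnitaryGroup n ℂ) : Matrix n n ℂ) - 1‖ ≤ δ)
    (s : ℕ) (hsK : s ≤ P.m + P.K) (p : Plaq P s) {M R : ℝ} (hM1 : M ≤ 1)
    (hV : ∀ c : PBond P s, ‖((Averaging.iter (fun i => blockAvg (P := P) (j := i) (expMeanLogSU (n := n))) s U c : Matrix.specialUnitaryGroup n ℂ) :
      Matrix n n ℂ) - 1‖ ≤ M)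
    (hZ : ∀ c : PBond P s, ‖((Averaging.iter (fun i => blockAvg (P := P) (j := i) (expMeanLogSU (n := n))) s U c : Matrix.specialUnitaryGroup n ℂ) :
      Matrix n n ℂ) - 1 - Q s (fun b => ((U b : Matrix.specialUnitaryGroup n ℂ) : Matrix n n ℂ) - 1) c‖ ≤ R) :
    GaugeGroup.dist1 (GaugeField.plaqHol (Averaging.iter (fun i => blockAvg (P := P) (j := i) (expMeanLogSU (n := n))) s U) p) ≤
      (((P.L : ℝ) ^ s) ^ P.d)⁻¹ *
        (∑ r : Fin P.d → Fin (P.L ^ s), ∑ a ∈ range (P.L ^ s), ∑ b ∈ range (P.L ^ s),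
          ‖((U ⟨runSite (runSite (Site.fibreSite 0 s p.src r) p.μ a) p.ν b, p.μ⟩ *
              U ⟨(runSite (runSite (Site.fibreSite 0 s p.src r) p.μ a) p.ν b).shift p.μ, p.ν⟩ *
              (U ⟨(runSite (runSite (Site.fibreSite 0 s p.src r) p.μ a) p.ν b).shift p.ν, p.μ⟩)⁻¹ *
              (U ⟨runSite (runSite (Site.fibreSite 0 s p.src r) p.μ a) p.ν b, p.ν⟩)⁻¹ : Matrix.specialUnitaryGroup n ℂ) : Matrix n n ℂ) - 1‖) +
      13 * ((P.L : ℝ) ^ s * δ) ^ 2 + (4 * R + 13 * M ^ 2) := by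
  -- letters
  set Y : PBond P 0 → Matrix n n ℂ := fun b => ((U b : Matrix.specialUnitaryGroup n ℂ) : Matrix n n ℂ) - 1 with hY
  set N : ℕ := P.L ^ s with hNdef
  set z : (Fin P.d → Fin N) → ℕ → ℕ → Site P 0 := fun r a b => runSite (runSite (Site.fibreSite 0 s p.src r) p.μ a) p.ν b with hz
  have hL0 : (0 : ℝ) < P.L := Nat.cast_pos.mpr P.L_pos
  have hLs : (0 : ℝ) < (P.L : ℝ) ^ s := pow_pos hL0 s
  have hNr : (N : ℝ) = (P.L : ℝ) ^ s := by rw [hNdef, Nat.cast_pow]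
  -- piece (iii), coarse end (from the displayed expansion)
  have h1 := dist1_plaqHol_le_norm_curl_add (Averaging.iter (fun i => blockAvg (P := P) (j := i) (expMeanLogSU (n := n))) s U) (Q s Y) p hM1 hV hZ
  -- piece (i): the curl of `Q^{(s)}Y` is the rigid flux
  have hflux := curl_iterLinAvg_eq_rigidFlux_offsets Q hQ0 hQs hsK Y p.src p.μ p.ν
  -- piece (iii), fine end: every unit circulation is the plaquette deviation to second order
  have hfine : ∀ (r : Fin P.d → Fin N) (a b : ℕ),
      ‖Y ⟨z r a b, p.μ⟩ + Y ⟨runSite (z r a b) p.μ 1, p.ν⟩ - Y ⟨runSite (z r a b) p.ν 1, p.μ⟩ - Y ⟨z r a b, p.ν⟩‖ ≤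
        ‖((U ⟨z r a b, p.μ⟩ * U ⟨(z r a b).shift p.μ, p.ν⟩ * (U ⟨(z r a b).shift p.ν, p.μ⟩)⁻¹ * (U ⟨z r a b, p.ν⟩)⁻¹ :
            Matrix.specialUnitaryGroup n ℂ) : Matrix n n ℂ) - 1‖ + 13 * δ ^ 2 := by
    intro r a b
    rw [runSite_one', runSite_one']
    exact norm_fineCurl_le_dist1_add U (z r a b) p.μ p.ν hδ1 (hU _) (hU _) (hU _) (hU _)
  -- the norm of the rigid flux
  have hsum : ‖∑ r : Fin P.d → Fin N, ∑ a ∈ range N, ∑ b ∈ range N,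
        (Y ⟨z r a b, p.μ⟩ + Y ⟨runSite (z r a b) p.μ 1, p.ν⟩ - Y ⟨runSite (z r a b) p.ν 1, p.μ⟩ - Y ⟨z r a b, p.ν⟩)‖ ≤
      (∑ r : Fin P.d → Fin N, ∑ a ∈ range N, ∑ b ∈ range N,
        ‖((U ⟨z r a b, p.μ⟩ * U ⟨(z r a b).shift p.μ, p.ν⟩ * (U ⟨(z r a b).shift p.ν, p.μ⟩)⁻¹ * (U ⟨z r a b, p.ν⟩)⁻¹ :
            Matrix.specialUnitaryGroup n ℂ) : Matrix n n ℂ) - 1‖) + (N : ℝ) ^ P.d * ((N : ℝ) * ((N : ℝ) * (13 * δ ^ 2))) := by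
    refine (norm_sum_le _ _).trans ?_
    have hr : ∀ r : Fin P.d → Fin N, ‖∑ a ∈ range N, ∑ b ∈ range N,
          (Y ⟨z r a b, p.μ⟩ + Y ⟨runSite (z r a b) p.μ 1, p.ν⟩ - Y ⟨runSite (z r a b) p.ν 1, p.μ⟩ - Y ⟨z r a b, p.ν⟩)‖ ≤
        (∑ a ∈ range N, ∑ b ∈ range N,
          ‖((U ⟨z r a b, p.μ⟩ * U ⟨(z r a b).shift p.μ, p.ν⟩ * (U ⟨(z r a b).shift p.ν, p.μ⟩)⁻¹ * (U ⟨z r a b, p.ν⟩)⁻¹ :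
              Matrix.specialUnitaryGroup n ℂ) : Matrix n n ℂ) - 1‖) + (N : ℝ) * ((N : ℝ) * (13 * δ ^ 2)) := by
      intro r
      refine (norm_sum_le _ _).trans ?_
      have ha : ∀ a ∈ range N, ‖∑ b ∈ range N,
            (Y ⟨z r a b, p.μ⟩ + Y ⟨runSite (z r a b) p.μ 1, p.ν⟩ - Y ⟨runSite (z r a b) p.ν 1, p.μ⟩ - Y ⟨z r a b, p.ν⟩)‖ ≤
          (∑ b ∈ range N,
            ‖((U ⟨z r a b, p.μ⟩ * U ⟨(z r a b).shift p.μ, p.ν⟩ * (U ⟨(z r a b).shift p.ν, p.μ⟩)⁻¹ * (U ⟨z r a b, p.ν⟩)⁻¹ :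
                Matrix.specialUnitaryGroup n ℂ) : Matrix n n ℂ) - 1‖) + (N : ℝ) * (13 * δ ^ 2) := by
        intro a _
        refine (norm_sum_le _ _).trans ?_
        have := Finset.sum_le_sum (s := range N) fun b _ => hfine r a b
        refine this.trans (le_of_eq ?_)
        rw [Finset.sum_add_distrib, Finset.sum_const, Finset.card_range, nsmul_eq_mul]
      refine (Finset.sum_le_sum ha).trans (le_of_eq ?_)
      rw [Finset.sum_add_distrib, Finset.sum_const, Finset.card_range, nsmul_eq_mul]
    refine (Finset.sum_le_sum fun r _ => hr r).trans (le_of_eq ?_)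
    rw [Finset.sum_add_distrib, Finset.sum_const, Finset.card_univ, Fintype.card_fun, Fintype.card_fin, Fintype.card_fin, nsmul_eq_mul]
    push_cast
    ring
  -- the curl's norm: `L^s · ((L^s)^d L^s)⁻¹ = ((L^s)^d)⁻¹`
  have hw : (P.L : ℝ) ^ s * ((((P.L : ℝ) ^ s) ^ P.d * (P.L : ℝ) ^ s)⁻¹) = (((P.L : ℝ) ^ s) ^ P.d)⁻¹ := by
    field_simp
  have hcurl : ‖Q s Y ⟨p.src, p.μ⟩ + Q s Y ⟨p.src.shift p.μ, p.ν⟩ - Q s Y ⟨p.src.shift p.ν, p.μ⟩ - Q s Y ⟨p.src, p.ν⟩‖ ≤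
      (((P.L : ℝ) ^ s) ^ P.d)⁻¹ *
        (∑ r : Fin P.d → Fin N, ∑ a ∈ range N, ∑ b ∈ range N,
          ‖((U ⟨z r a b, p.μ⟩ * U ⟨(z r a b).shift p.μ, p.ν⟩ * (U ⟨(z r a b).shift p.ν, p.μ⟩)⁻¹ * (U ⟨z r a b, p.ν⟩)⁻¹ :
              Matrix.specialUnitaryGroup n ℂ) : Matrix n n ℂ) - 1‖) + 13 * ((P.L : ℝ) ^ s * δ) ^ 2 := by
    rw [hflux, norm_smul, norm_smul, norm_pow, Complex.norm_natCast, norm_inv, Real.norm_eq_abs, abs_of_pos (by positivity)]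
    have hd : (0 : ℝ) ≤ (((P.L : ℝ) ^ s) ^ P.d)⁻¹ := by positivity
    calc (P.L : ℝ) ^ s * ((((P.L : ℝ) ^ s) ^ P.d * (P.L : ℝ) ^ s)⁻¹ * ‖_‖)
        = (((P.L : ℝ) ^ s) ^ P.d)⁻¹ * ‖∑ r : Fin P.d → Fin N, ∑ a ∈ range N, ∑ b ∈ range N,
            (Y ⟨z r a b, p.μ⟩ + Y ⟨runSite (z r a b) p.μ 1, p.ν⟩ - Y ⟨runSite (z r a b) p.ν 1, p.μ⟩ - Y ⟨z r a b, p.ν⟩)‖ := by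
          rw [← mul_assoc, hw]
      _ ≤ (((P.L : ℝ) ^ s) ^ P.d)⁻¹ * ((∑ r : Fin P.d → Fin N, ∑ a ∈ range N, ∑ b ∈ range N,
            ‖((U ⟨z r a b, p.μ⟩ * U ⟨(z r a b).shift p.μ, p.ν⟩ * (U ⟨(z r a b).shift p.ν, p.μ⟩)⁻¹ * (U ⟨z r a b, p.ν⟩)⁻¹ :
                Matrix.specialUnitaryGroup n ℂ) : Matrix n n ℂ) - 1‖) + (N : ℝ) ^ P.d * ((N : ℝ) * ((N : ℝ) * (13 * δ ^ 2)))) :=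
          mul_le_mul_of_nonneg_left hsum hd
      _ = _ := by
          rw [hNr, mul_add, ← mul_assoc ((((P.L : ℝ) ^ s) ^ P.d)⁻¹), inv_mul_cancel₀ (pow_ne_zero _ hLs.ne'), one_mul]
          ring
  linarith

end Torus

/-! ## §2 (69)_sym in the (70)–(71) letters, from the expansion at the level in hand -/

section ScalesForm

variable {L : ℕ} {S : Scales L}

/-- **★★ (69)_sym IN THE (70)–(71) LETTERS, ENGINE-GENERIC** (`SU(N)` on the tori of a `Scales`, any `GroupModel` reading, flat gauge): under the binders of
`dist1_plaqHol_iter_le_tripleSum_of_expansion`, `|Ū^{(s)}(∂p′) − 1| ≤ blockSum (L^s) ((L^s:ℕ)•zOf p′) p′.μ p′.ν (dev (liftCfg 𝔊 U) p′.μ p′.ν) + (13·(L^sδ)² + (4R + 13M²))` — the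
landed ✓`SymAvgBlockSum69.dist1_plaqHol_iter_le_blockSum` with the engine displayed. [cite: Balaban1985UV3, (67)–(69) p.273; Balaban1985Averaging, Prop. 4 (134)–(135) p.38] -/
theorem dist1_plaqHol_iter_le_blockSum_of_expansion {N : ℕ} [NeZero N] (𝔊 : GroupModel (Matrix.specialUnitaryGroup (Fin N) ℂ))
    (Q : (i : ℕ) → (PBond S.P 0 → Matrix (Fin N) (Fin N) ℂ) → PBond S.P i → Matrix (Fin N) (Fin N) ℂ)
    (hQ0 : ∀ Y, Q 0 Y = Y) (hQs : ∀ (i : ℕ) (Y : PBond S.P 0 → Matrix (Fin N) (Fin N) ℂ) (c : PBond S.P (i + 1)), Q (i + 1) Y c = linAvg (Q i Y) c)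
    (U : GaugeField S.P 0 (Matrix.specialUnitaryGroup (Fin N) ℂ)) {δ : ℝ} (hδ1 : δ ≤ 1)
    (hU : ∀ b, ‖((U b : Matrix.specialUnitaryGroup (Fin N) ℂ) : Matrix (Fin N) (Fin N) ℂ) - 1‖ ≤ δ)
    (s : ℕ) (hsK : s ≤ S.P.m + S.P.K) (p : Plaq S.P s) {M R : ℝ} (hM1 : M ≤ 1)
    (hV : ∀ c : PBond S.P s, ‖((Averaging.iter (fun i => blockAvg (P := S.P) (j := i) (expMeanLogSU (n := Fin N))) s U c :
      Matrix.specialUnitaryGroup (Fin N) ℂ) : Matrix (Fin N) (Fin N) ℂ) - 1‖ ≤ M)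
    (hZ : ∀ c : PBond S.P s, ‖((Averaging.iter (fun i => blockAvg (P := S.P) (j := i) (expMeanLogSU (n := Fin N))) s U c :
      Matrix.specialUnitaryGroup (Fin N) ℂ) : Matrix (Fin N) (Fin N) ℂ) - 1 -
        Q s (fun b => ((U b : Matrix.specialUnitaryGroup (Fin N) ℂ) : Matrix (Fin N) (Fin N) ℂ) - 1) c‖ ≤ R) :
    GaugeGroup.dist1 (GaugeField.plaqHol (Averaging.iter (fun i => blockAvg (P := S.P) (j := i) (expMeanLogSU (n := Fin N))) s U) p) ≤
      B10Eq70Squaring.blockSum (S.P.L ^ s) ((S.P.L ^ s : ℕ) • zOf p) p.μ p.ν (B10Eq70Squaring.dev (liftCfg 𝔊 U) p.μ p.ν) +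
      (13 * ((S.P.L : ℝ) ^ s * δ) ^ 2 + (4 * R + 13 * M ^ 2)) := by
  have h := dist1_plaqHol_iter_le_tripleSum_of_expansion Q hQ0 hQs U hδ1 hU s hsK p hM1 hV hZ
  rw [blockSum_dev_liftCfg_eq 𝔊 p p.μ p.ν U]
  have e : ∀ (r : Fin S.P.d → Fin (S.P.L ^ s)) (a b : ℕ),
      GaugeGroup.dist1 (plaqVar U (runSite (runSite (Site.fibreSite 0 s p.src r) p.μ a) p.ν b) p.μ p.ν) =
        ‖((U ⟨runSite (runSite (Site.fibreSite 0 s p.src r) p.μ a) p.ν b, p.μ⟩ *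
            U ⟨(runSite (runSite (Site.fibreSite 0 s p.src r) p.μ a) p.ν b).shift p.μ, p.ν⟩ *
            (U ⟨(runSite (runSite (Site.fibreSite 0 s p.src r) p.μ a) p.ν b).shift p.ν, p.μ⟩)⁻¹ *
            (U ⟨runSite (runSite (Site.fibreSite 0 s p.src r) p.μ a) p.ν b, p.ν⟩)⁻¹ : Matrix.specialUnitaryGroup (Fin N) ℂ) :
            Matrix (Fin N) (Fin N) ℂ) - 1‖ := fun r a b => by
    rw [dist1_SU_eq]; rfl
  simp only [e]
  linarith

end ScalesForm

/-! ## §3 (69)_sym for a read-regular field, the Prop-4 engine displayed -/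

section Cover

variable {L : ℕ} {S : Scales L}

/-- **★★★ [Balaban1985UV3] (69) FOR THE SYMMETRIC (0.4)-AVERAGE OF RECORD, READ-REGULAR FIELD, ENGINE-GENERIC** (`SU(N)` on the tori of a `Scales`, any `GroupModel` reading of
the lift).  Let `p′` be a level-`j` plaquette (`j + 1 ≤ m + K`), `U` a finest field whose fine plaquettes with all corners in `Δ′(p′) = plaqCover p′` satisfy `‖U(∂q) − 1‖ ≤ a`,
`δ := (d+2)·L^j·a ≤ 1`, and let `hP4` be [Balaban1985Averaging] Prop. 4 AT LEVEL `j` FOR EVERY GLOBALLY `δ`-SMALL FIELD `Ũ` (any engine; `Q = linAvgIterM` the linearised average of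
record): `‖Ū̃^{(j)}(c) − 1‖ ≤ M ≤ 1` and `‖Ū̃^{(j)}(c) − 1 − (Q^{(j)}Ỹ)(c)‖ ≤ R`.  Then
`|Ū^{(j)}(∂p′) − 1| ≤ blockSum (L^j) (L^j•zOf p′) μ ν (dev (liftCfg 𝔊 U) μ ν) + (13·(L^jδ)² + (4R + 13M²))`.  Proof = ✓`SymAvgSixtyNine.dist1_plaqHol_iter_le_blockSum_of_cover`'s: the clamp
(✓`SymAvgGaugeClamp.exists_clamp`) gives a globally `δ`-small `Ũ` with the same left side and the same plaquette deviations on `Δ′(p′)` ;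
§2 bounds `Ũ`'s left side; ✓`blockSum_dev_liftCfg_congr_of_cover` identifies the block sums.  NO block-size floor, NO window: both live in whichever engine supplies `hP4`.
[cite: Balaban1985UV3, (67)–(69) p.273; Balaban1985Averaging, Prop. 2 (52)–(54) p.26, Prop. 4 (134)–(135) p.38, (8)-(11) p.19] -/
theorem dist1_plaqHol_iter_le_blockSum_of_cover_of_expansion {N : ℕ} [NeZero N] (𝔊 : GroupModel (Matrix.specialUnitaryGroup (Fin N) ℂ))
    {j : ℕ} (hj : j + 1 ≤ S.P.m + S.P.K) (p : Plaq S.P j)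
    (U : GaugeField S.P 0 (Matrix.specialUnitaryGroup (Fin N) ℂ)) {a : ℝ} (ha : 0 ≤ a)
    (hU : ∀ q ∈ plaqsIn 0 (plaqCover p), ‖((GaugeField.plaqHol U q : Matrix.specialUnitaryGroup (Fin N) ℂ) : Matrix (Fin N) (Fin N) ℂ) - 1‖ ≤ a)
    (hδ1 : ((S.P.d : ℝ) + 2) * (S.P.L : ℝ) ^ j * a ≤ 1) {M R : ℝ} (hM1 : M ≤ 1)
    (hP4 : ∀ Ut : GaugeField S.P 0 (Matrix.specialUnitaryGroup (Fin N) ℂ),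
      (∀ b, ‖((Ut b : Matrix.specialUnitaryGroup (Fin N) ℂ) : Matrix (Fin N) (Fin N) ℂ) - 1‖ ≤ ((S.P.d : ℝ) + 2) * (S.P.L : ℝ) ^ j * a) →
        ∀ c : PBond S.P j,
          ‖((Averaging.iter (fun i => blockAvg (P := S.P) (j := i) (expMeanLogSU (n := Fin N))) j Ut c : Matrix.specialUnitaryGroup (Fin N) ℂ) :
              Matrix (Fin N) (Fin N) ℂ) - 1‖ ≤ M ∧
          ‖((Averaging.iter (fun i => blockAvg (P := S.P) (j := i) (expMeanLogSU (n := Fin N))) j Ut c : Matrix.specialUnitaryGroup (Fin N) ℂ) :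
              Matrix (Fin N) (Fin N) ℂ) - 1 -
            linAvgIterM (P := S.P) (n := Fin N) j (fun b => ((Ut b : Matrix.specialUnitaryGroup (Fin N) ℂ) : Matrix (Fin N) (Fin N) ℂ) - 1) c‖ ≤ R) :
    GaugeGroup.dist1 (GaugeField.plaqHol (Averaging.iter (fun i => blockAvg (P := S.P) (j := i) (expMeanLogSU (n := Fin N))) j U) p) ≤
      B10Eq70Squaring.blockSum (S.P.L ^ j) ((S.P.L ^ j : ℕ) • zOf p) p.μ p.ν (B10Eq70Squaring.dev (liftCfg 𝔊 U) p.μ p.ν) +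
      (13 * ((S.P.L : ℝ) ^ j * (((S.P.d : ℝ) + 2) * (S.P.L : ℝ) ^ j * a)) ^ 2 + (4 * R + 13 * M ^ 2)) := by
  have hjK : j ≤ S.P.m + S.P.K := by omega
  have hdist : ∀ g : Matrix.specialUnitaryGroup (Fin N) ℂ, dist1 g = ‖(g : Matrix (Fin N) (Fin N) ℂ) - 1‖ := fun g => rfl
  have hU' : ∀ q ∈ plaqsIn 0 (plaqCover p), dist1 (GaugeField.plaqHol U q) ≤ a := fun q hq => by rw [hdist]; exact hU q hq
  -- piece (ii): the clamp (engine-free part)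
  obtain ⟨v, Ut, -, -, hsmall, hplaq, -, hp⟩ := exists_clamp (expMeanLogSU (n := Fin N)) hj p U ha hU'
  have hsmall' : ∀ b : PBond S.P 0, ‖((Ut b : Matrix.specialUnitaryGroup (Fin N) ℂ) : Matrix (Fin N) (Fin N) ℂ) - 1‖ ≤ ((S.P.d : ℝ) + 2) * (S.P.L : ℝ) ^ j * a :=
    fun b => by rw [← hdist]; exact hsmall b
  -- the knit (i)+(iii)+(iv) for the globally small copy, with the displayed expansion
  have hknit := dist1_plaqHol_iter_le_blockSum_of_expansion 𝔊 (linAvgIterM (P := S.P) (n := Fin N)) (fun Y => linAvgIterM_zero Y)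
    (fun s Y c => linAvgIterM_succ s Y c) Ut hδ1 hsmall' j hjK p hM1 (fun c => (hP4 Ut hsmall' c).1) (fun c => (hP4 Ut hsmall' c).2)
  -- transport the left side
  have hleft : GaugeGroup.dist1 (GaugeField.plaqHol (Averaging.iter (fun i => blockAvg (P := S.P) (j := i) (expMeanLogSU (n := Fin N))) j U) p) =
      GaugeGroup.dist1 (GaugeField.plaqHol (Averaging.iter (fun i => blockAvg (P := S.P) (j := i) (expMeanLogSU (n := Fin N))) j Ut) p) := by
    rw [hp, GaugeGroup.dist1_conj]
  -- transport the right side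
  have hright := blockSum_dev_liftCfg_congr_of_cover 𝔊 hjK p U Ut fun q hq => by
    rw [hplaq q hq, GaugeGroup.dist1_conj]
  rw [hleft, ← hright]
  exact hknit

end Cover

end Summit.QuantumFields.YangMills.Theorems.SymAvgSixtyNineOfExpansion

end
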